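import Literature.MathematicalPhysics.QuantumFieldTheory.ContinuumLimitsYM2Measurability
import Literature.MathematicalPhysics.QuantumFieldTheory.ContinuumLimitsYM2Haar
import HarnessLib

/-!
# `YM₂` on the lattice torus, IV: the heat-kernel lattice theory on an abstract `C × R` torus

Fourth sibling proof file of
`Literature/MathematicalPhysics/QuantumFieldTheory/ContinuumLimits.lean` towards
`ym2_exists_heatKernel_holds` (Sengupta, Mem. AMS 600 (1997) Thm 4.2; Driver, CMP 123 (1989)).

The exact solution of the heat-kernel lattice gauge theory (Migdal 1975) proceeds by integrating
out edge variables one at a time; each integration merges two faces (convolution move) and the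
intermediate "lattices" are no longer square tori.  To keep every stage inside one fixed
measurable space we work with an **abstract torus datum** on an arbitrary coordinate space
`ι → G`: `D : TorusData ι C R` records, for a `C × R` discrete torus (`C` columns `i : ZMod C`,
`R` rows `j : ZMod R`), which coordinate `D.h j i : ι` carries the horizontal edge
`(i, j) → (i+1, j)`, which coordinate `D.v i j` carries the vertical edge `(i, j) → (i, j+1)`, and
face weights in product form: the plaquette at `(i, j)` carries the heat kernel at time
`D.σ i * D.τ j` (its "area").  From it:

* `plaq D U i j = U(h j i) U(v (i+1) j) U(h (j+1) i)⁻¹ U(v i j)⁻¹`, the plaquette holonomy;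
* `modelW p D U = ∏_{i,j} ofReal (p_{σᵢτⱼ}(plaq D U i j))`, the (un-normalised) heat-kernel weight;
* `icoProd e U a u w = U(e a u) U(e a (u+1)) ⋯ U(e a (w-1))`, ordered edge products, and
  `modelHol D U n₁ n₂`, the holonomy of the `n₁ × n₂` rectangle based at the origin;
* `blockF p D U i u w`, the weight of the merged column block `[u, w)` in column `i`
  (time `σᵢ (τ_u + ⋯ + τ_{w-1})`), and `stageF`, the integrand at an intermediate stage of the
  row-merging (per-column heights of the bottom and top merged blocks);
* `D.transpose` (swap the roles of rows and columns: plaquette holonomies are inverted, so the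
  weight is unchanged by inversion symmetry of `p`) and `D.reduce n₂`, the two-row torus obtained
  by merging the rows `[0, n₂)` and `[n₂, R)`.

This file contains the definitions, their pointwise algebra (transposition, update/locality
lemmas, the identification of the initial and final stages) and the measurability of all
integrands (file I).  The integrations are carried out in the next files. [folklore]
-/

noncomputable section

open MeasureTheory Filter Topology Function
open scoped ENNReal
open Literature.MathematicalPhysics.QuantumLattice

namespace Literature.MathematicalPhysics.QuantumFieldTheory.YM2

variable {G : Type*} [Group G] {ι : Type*}

/-! ### Casts of small naturals into `ZMod R` -/

/-- Naturals below `R` have distinct images in `ZMod R`. [folklore] -/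
theorem natCast_zmod_injOn {R a b : ℕ} (ha : a < R) (hb : b < R) (h : (a : ZMod R) = b) :
    a = b := by
  have h' := (ZMod.natCast_eq_natCast_iff' a b R).1 h
  rwa [Nat.mod_eq_of_lt ha, Nat.mod_eq_of_lt hb] at h'

/-- A natural `0 < a < R` is non-zero in `ZMod R`. [folklore] -/
theorem natCast_zmod_ne_zero {R a : ℕ} (h0 : 0 < a) (ha : a < R) : (a : ZMod R) ≠ 0 := by
  intro h
  have := natCast_zmod_injOn ha (h0.trans ha) (h.trans Nat.cast_zero.symm)
  omega

/-- For `0 < a < R` and `b ≤ R` with `a ≠ b`, the casts differ (the case `b = R ↦ 0`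
included). [folklore] -/
theorem natCast_zmod_ne {R a b : ℕ} (h0 : 0 < a) (ha : a < R) (hb : b ≤ R) (hab : a ≠ b) :
    (a : ZMod R) ≠ b := by
  rcases hb.lt_or_eq with hb | rfl
  · exact fun h => hab (natCast_zmod_injOn ha hb h)
  · rw [ZMod.natCast_self]
    exact natCast_zmod_ne_zero h0 ha

/-! ### Ordered edge products -/

section IcoProd

variable {α β : Type*} [NatCast β]

/-- The ordered product `U(e a u) U(e a (u+1)) ⋯ U(e a (w-1))` of the variables on the
consecutive edges `e a k`, `u ≤ k < w`, of an edge-labelling `e` (empty product if `w ≤ u`). [folklore] -/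
def icoProd (e : α → β → ι) (U : ι → G) (a : α) (u w : ℕ) : G :=
  ((List.range' u (w - u)).map fun k : ℕ => U (e a (k : β))).prod

variable {e : α → β → ι} {U : ι → G} {a : α} {u k w : ℕ}

omit [NatCast β] in
/-- Empty product. [folklore] -/
@[simp] theorem icoProd_self [NatCast β] : icoProd e U a u u = (1 : G) := by simp [icoProd]

omit [NatCast β] in
/-- One edge. [folklore] -/
@[simp] theorem icoProd_succ_self [NatCast β] : icoProd e U a u (u + 1) = U (e a (u : β)) := by
  simp [icoProd]

/-- Concatenation of consecutive intervals. [folklore] -/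
theorem icoProd_mul_icoProd (huk : u ≤ k) (hkw : k ≤ w) :
    icoProd e U a u k * icoProd e U a k w = icoProd e U a u w := by
  unfold icoProd
  rw [← List.prod_append, ← List.map_append]
  congr 2
  rw [show w - u = (k - u) + (w - k) by omega, ← List.range'_append_1, Nat.add_sub_cancel' huk]

/-- Appending one edge on the right. [folklore] -/
theorem icoProd_succ (huw : u ≤ w) :
    icoProd e U a u (w + 1) = icoProd e U a u w * U (e a (w : β)) := by
  rw [← icoProd_mul_icoProd huw (Nat.le_succ w), icoProd_succ_self]

/-- Splitting off the first edge. [folklore] -/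
theorem icoProd_eq_mul (huw : u < w) :
    icoProd e U a u w = U (e a (u : β)) * icoProd e U a (u + 1) w := by
  rw [← icoProd_mul_icoProd (Nat.le_succ u) huw, icoProd_succ_self]

/-- Locality: changing a coordinate not on the interval does not change the product. [folklore] -/
theorem icoProd_update [DecidableEq ι] {e₀ : ι} (hne : ∀ k, u ≤ k → k < w → e a (k : β) ≠ e₀)
    (x : G) : icoProd e (update U e₀ x) a u w = icoProd e U a u w := by
  unfold icoProd
  congr 1
  apply List.map_congr_left
  intro k hk
  rw [List.mem_range'_1] at hk
  exact update_of_ne (hne k hk.1 (by omega)) _ _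

/-- Congruence: the product only reads the variables on its edges. [folklore] -/
theorem icoProd_congr {U' : ι → G} (hUU' : ∀ k, u ≤ k → k < w → U (e a (k : β)) = U' (e a (k : β))) :
    icoProd e U a u w = icoProd e U' a u w := by
  unfold icoProd
  congr 1
  apply List.map_congr_left
  intro k hk
  rw [List.mem_range'_1] at hk
  exact hUU' k hk.1 (by omega)

/-- Continuous functions of an ordered edge product are measurable (file I). [folklore] -/
theorem measurable_comp_icoProd [TopologicalSpace G] [IsTopologicalGroup G] [CompactSpace G]
    [MeasurableSpace G] [BorelSpace G] (e : α → β → ι) (a : α) (u w : ℕ) (φ : G → ℝ)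
    (hφ : Continuous φ) : Measurable fun U : ι → G => φ (icoProd e U a u w) := by
  unfold icoProd
  simp only [List.range'_eq_map_range, List.map_map, Function.comp_def]
  exact measurable_comp_prod_range (w := fun k (U : ι → G) => U (e a ((u + k : ℕ) : β)))
    (fun k => measurable_comp_apply _) (w - u) φ hφ

end IcoProd

/-! ### Torus data, plaquettes, weight, loop -/

/-- An abstract `C × R` torus drawn on the coordinate space `ι → G`: edge labels and face times in
product form (see the module docstring). [folklore] -/
structure TorusData (ι : Type*) (C R : ℕ) where
  /-- column factor of the face time -/
  σ : ZMod C → ℝ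
  /-- row factor of the face time -/
  τ : ZMod R → ℝ
  /-- coordinate of the horizontal edge `(i, j) → (i+1, j)`: `h j i` -/
  h : ZMod R → ZMod C → ι
  /-- coordinate of the vertical edge `(i, j) → (i, j+1)`: `v i j` -/
  v : ZMod C → ZMod R → ι

namespace TorusData

variable {C R : ℕ}

/-- Well-formedness: positive face times and pairwise distinct edges. [folklore] -/
structure IsWF (D : TorusData ι C R) : Prop where
  /-- column factors are positive -/
  σ_pos : ∀ i, 0 < D.σ i
  /-- row factors are positive -/
  τ_pos : ∀ j, 0 < D.τ j
  /-- horizontal edges are distinct -/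
  h_inj : ∀ j i j' i', D.h j i = D.h j' i' → j = j' ∧ i = i'
  /-- vertical edges are distinct -/
  v_inj : ∀ i j i' j', D.v i j = D.v i' j' → i = i' ∧ j = j'
  /-- horizontal and vertical edges are distinct -/
  h_ne_v : ∀ j i i' j', D.h j i ≠ D.v i' j'

/-- Transposition: exchange rows and columns. [folklore] -/
def transpose (D : TorusData ι C R) : TorusData ι R C := ⟨D.τ, D.σ, D.v, D.h⟩

/-- Transposition preserves well-formedness. [folklore] -/
theorem IsWF.transpose {D : TorusData ι C R} (hD : D.IsWF) : D.transpose.IsWF where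
  σ_pos := hD.τ_pos
  τ_pos := hD.σ_pos
  h_inj i j i' j' h := hD.v_inj i j i' j' h
  v_inj j i j' i' h := hD.h_inj j i j' i' h
  h_ne_v i j j' i' h := hD.h_ne_v j' i' i j h.symm

/-- The two-row torus obtained by merging the plaquette rows `[0, n₂)` and `[n₂, R)`: horizontal
rows `0 ↦ D.h 0`, `1 ↦ D.h n₂`, vertical edges `v i 0 ↦ D.v i 0`, `v i 1 ↦ D.v i n₂` (the renamed
column products), row times the sums. [folklore] -/
def reduce [NeZero R] (D : TorusData ι C R) (n₂ : ℕ) : TorusData ι C 2 where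
  σ := D.σ
  τ j := if j = 0 then ∑ k ∈ Finset.range n₂, D.τ k else ∑ k ∈ Finset.Ico n₂ R, D.τ k
  h j := if j = 0 then D.h 0 else D.h n₂
  v i j := if j = 0 then D.v i 0 else D.v i n₂

/-- The reduced torus is well formed when `1 ≤ n₂ < R`. [folklore] -/
theorem IsWF.reduce [NeZero R] {D : TorusData ι C R} (hD : D.IsWF) {n₂ : ℕ} (h1 : 1 ≤ n₂)
    (h2 : n₂ < R) : (D.reduce n₂).IsWF where
  σ_pos := hD.σ_pos
  τ_pos j := by
    simp only [TorusData.reduce]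
    split_ifs
    · exact Finset.sum_pos (fun k _ => hD.τ_pos _) (Finset.nonempty_range_iff.2 (by omega))
    · exact Finset.sum_pos (fun k _ => hD.τ_pos _) (Finset.nonempty_Ico.2 h2)
  h_inj j i j' i' h := by
    have hn : ((n₂ : ℕ) : ZMod R) ≠ 0 := natCast_zmod_ne_zero h1 h2
    simp only [TorusData.reduce] at h
    have key : ∀ a b : ZMod 2, a ≠ 0 → b ≠ 0 → a = b := by decide
    split_ifs at h with ha hb hb
    · exact ⟨ha.trans hb.symm, (hD.h_inj _ _ _ _ h).2⟩
    · exact absurd (hD.h_inj _ _ _ _ h).1.symm hn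
    · exact absurd (hD.h_inj _ _ _ _ h).1 hn
    · exact ⟨key _ _ ha hb, (hD.h_inj _ _ _ _ h).2⟩
  v_inj i j i' j' h := by
    have hn : ((n₂ : ℕ) : ZMod R) ≠ 0 := natCast_zmod_ne_zero h1 h2
    simp only [TorusData.reduce] at h
    have key : ∀ a b : ZMod 2, a ≠ 0 → b ≠ 0 → a = b := by decide
    split_ifs at h with ha hb hb
    · exact ⟨(hD.v_inj _ _ _ _ h).1, ha.trans hb.symm⟩
    · exact absurd (hD.v_inj _ _ _ _ h).2.symm hn
    · exact absurd (hD.v_inj _ _ _ _ h).2 hn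
    · exact ⟨(hD.v_inj _ _ _ _ h).1, key _ _ ha hb⟩
  h_ne_v j i i' j' h := by
    simp only [TorusData.reduce] at h
    split_ifs at h <;> exact hD.h_ne_v _ _ _ _ h

end TorusData

open TorusData

section Model

variable {C R : ℕ}

/-- Plaquette holonomy at `(i, j)`: `U(h j i) U(v (i+1) j) U(h (j+1) i)⁻¹ U(v i j)⁻¹`. [folklore] -/
def plaq (D : TorusData ι C R) (U : ι → G) (i : ZMod C) (j : ZMod R) : G :=
  U (D.h j i) * U (D.v (i + 1) j) * (U (D.h (j + 1) i))⁻¹ * (U (D.v i j))⁻¹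

/-- The heat-kernel weight `∏_{i,j} p_{σᵢτⱼ}(plaq D U i j)` (as `ℝ≥0∞`). [folklore] -/
def modelW [NeZero C] [NeZero R] (p : ℝ → G → ℝ) (D : TorusData ι C R) (U : ι → G) : ℝ≥0∞ :=
  ∏ i : ZMod C, ∏ j : ZMod R, ENNReal.ofReal (p (D.σ i * D.τ j) (plaq D U i j))

/-- Holonomy of the `n₁ × n₂` rectangle based at the origin (right `n₁`, up `n₂`, back). [folklore] -/
def modelHol (D : TorusData ι C R) (U : ι → G) (n₁ n₂ : ℕ) : G :=
  icoProd D.h U 0 0 n₁ * icoProd D.v U (n₁ : ZMod C) 0 n₂ * (icoProd D.h U (n₂ : ZMod R) 0 n₁)⁻¹ *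
    (icoProd D.v U 0 0 n₂)⁻¹

/-- The full integrand `ofReal (f (hol)) · weight` of the loop expectation's numerator. [folklore] -/
def modelI [NeZero C] [NeZero R] (p : ℝ → G → ℝ) (f : G → ℝ) (D : TorusData ι C R) (n₁ n₂ : ℕ)
    (U : ι → G) : ℝ≥0∞ :=
  ENNReal.ofReal (f (modelHol D U n₁ n₂)) * modelW p D U

/-- Transposition inverts plaquette holonomies. [folklore] -/
theorem plaq_transpose (D : TorusData ι C R) (U : ι → G) (i : ZMod C) (j : ZMod R) :
    plaq D.transpose U j i = (plaq D U i j)⁻¹ := by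
  simp only [plaq, TorusData.transpose, mul_inv_rev, inv_inv, mul_assoc]

/-- Transposition inverts the rectangle holonomy. [folklore] -/
theorem modelHol_transpose (D : TorusData ι C R) (U : ι → G) (n₁ n₂ : ℕ) :
    modelHol D.transpose U n₂ n₁ = (modelHol D U n₁ n₂)⁻¹ := by
  simp only [modelHol, TorusData.transpose, mul_inv_rev, inv_inv, mul_assoc]

variable [TopologicalSpace G] [IsTopologicalGroup G] [CompactSpace G] [MeasurableSpace G]
  [BorelSpace G]

/-- Transposition preserves the weight (inversion symmetry of the heat kernel). [folklore] -/
theorem modelW_transpose [NeZero C] [NeZero R] {p : ℝ → G → ℝ} (hp : IsGroupHeatKernel p)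
    {D : TorusData ι C R} (hD : D.IsWF) (U : ι → G) :
    modelW p D.transpose U = modelW p D U := by
  unfold modelW
  rw [Finset.prod_comm]
  refine Finset.prod_congr rfl fun i _ => Finset.prod_congr rfl fun j _ => ?_
  rw [plaq_transpose]
  simp only [TorusData.transpose]
  rw [hp.symm _ (mul_pos (hD.τ_pos j) (hD.σ_pos i)), mul_comm (D.τ j)]

/-- Transposition of the full integrand: `f` is replaced by `f ∘ (·)⁻¹`. [folklore] -/
theorem modelI_transpose [NeZero C] [NeZero R] {p : ℝ → G → ℝ} (hp : IsGroupHeatKernel p)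
    (f : G → ℝ) {D : TorusData ι C R} (hD : D.IsWF) (n₁ n₂ : ℕ) (U : ι → G) :
    modelI p (fun g => f g⁻¹) D.transpose n₂ n₁ U = modelI p f D n₁ n₂ U := by
  simp only [modelI, modelHol_transpose, inv_inv, modelW_transpose hp hD]

/-- Continuous functions of a plaquette holonomy are measurable (file I). [folklore] -/
theorem measurable_comp_plaq (D : TorusData ι C R) (i : ZMod C) (j : ZMod R) (φ : G → ℝ)
    (hφ : Continuous φ) : Measurable fun U : ι → G => φ (plaq D U i j) := by
  unfold plaq
  exact measurable_comp_mul (measurable_comp_mul (measurable_comp_mul (measurable_comp_apply _)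
    (measurable_comp_apply _)) (measurable_comp_inv (measurable_comp_apply _)))
    (measurable_comp_inv (measurable_comp_apply _)) φ hφ

/-- The weight is measurable for the product σ-algebra. [folklore] -/
theorem measurable_modelW [NeZero C] [NeZero R] {p : ℝ → G → ℝ} (hp : IsGroupHeatKernel p)
    {D : TorusData ι C R} (hD : D.IsWF) : Measurable (modelW p D : (ι → G) → ℝ≥0∞) := by
  unfold modelW
  refine Finset.measurable_prod _ fun i _ => Finset.measurable_prod _ fun j _ => ?_
  exact measurable_ofReal_comp (measurable_comp_plaq D i j) _
    (hp.continuous (mul_pos (hD.σ_pos i) (hD.τ_pos j)))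

/-- Continuous functions of the rectangle holonomy are measurable. [folklore] -/
theorem measurable_comp_modelHol (D : TorusData ι C R) (n₁ n₂ : ℕ) (φ : G → ℝ)
    (hφ : Continuous φ) : Measurable fun U : ι → G => φ (modelHol D U n₁ n₂) := by
  unfold modelHol
  exact measurable_comp_mul (measurable_comp_mul (measurable_comp_mul
    (measurable_comp_icoProd _ _ _ _) (measurable_comp_icoProd _ _ _ _))
    (measurable_comp_inv (measurable_comp_icoProd _ _ _ _)))
    (measurable_comp_inv (measurable_comp_icoProd _ _ _ _)) φ hφ

/-- The full integrand is measurable. [folklore] -/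
theorem measurable_modelI [NeZero C] [NeZero R] {p : ℝ → G → ℝ} (hp : IsGroupHeatKernel p)
    {f : G → ℝ} (hf : Continuous f) {D : TorusData ι C R} (hD : D.IsWF) (n₁ n₂ : ℕ) :
    Measurable (modelI p f D n₁ n₂ : (ι → G) → ℝ≥0∞) :=
  (measurable_ofReal_comp (measurable_comp_modelHol D n₁ n₂) f hf).mul (measurable_modelW hp hD)

end Model

/-! ### Column blocks and the stage integrand -/

section Stage

variable {C R : ℕ} [NeZero C] [NeZero R]

/-- Weight of the merged block of plaquettes `(i, u), …, (i, w-1)` of column `i`: the heat kernel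
at time `σᵢ (τ_u + ⋯ + τ_{w-1})` of the block holonomy
`U(h u i) · (U(v (i+1) u) ⋯ U(v (i+1) (w-1))) · U(h w i)⁻¹ · (U(v i u) ⋯ U(v i (w-1)))⁻¹`. [folklore] -/
def blockF (p : ℝ → G → ℝ) (D : TorusData ι C R) (U : ι → G) (i : ZMod C) (u w : ℕ) : ℝ≥0∞ :=
  ENNReal.ofReal (p (D.σ i * ∑ j ∈ Finset.Ico u w, D.τ j)
    (U (D.h u i) * icoProd D.v U (i + 1) u w * (U (D.h w i))⁻¹ * (icoProd D.v U i u w)⁻¹))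

/-- The integrand at an intermediate stage of the row merging: in column `i` the rows `[0, kf i)`
and `[n₂, lf i)` are merged into blocks, the rows in `[kf i, n₂)` and `[lf i, R)` are still unit
plaquettes; times the loop factor `ofReal (f (hol))`. [folklore] -/
def stageF (p : ℝ → G → ℝ) (f : G → ℝ) (D : TorusData ι C R) (n₁ n₂ : ℕ) (kf lf : ZMod C → ℕ)
    (U : ι → G) : ℝ≥0∞ :=
  ENNReal.ofReal (f (modelHol D U n₁ n₂)) *
    ∏ i : ZMod C, (blockF p D U i 0 (kf i) * (∏ j ∈ Finset.Ico (kf i) n₂, blockF p D U i j (j + 1)) *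
      (blockF p D U i n₂ (lf i) * ∏ j ∈ Finset.Ico (lf i) R, blockF p D U i j (j + 1)))

omit [NeZero C] [NeZero R] in
/-- A unit block is a plaquette weight. [folklore] -/
theorem blockF_unit (p : ℝ → G → ℝ) (D : TorusData ι C R) (U : ι → G) (i : ZMod C) (j : ℕ) :
    blockF p D U i j (j + 1) = ENNReal.ofReal (p (D.σ i * D.τ j) (plaq D U i j)) := by
  simp only [blockF, Nat.Ico_succ_singleton, Finset.sum_singleton, icoProd_succ_self, plaq,
    Nat.cast_succ]

/-- Reindexing a product over `ZMod R` by the naturals `j < R`. [folklore] -/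
theorem prod_range_natCast (F : ZMod R → ℝ≥0∞) :
    ∏ j ∈ Finset.range R, F (j : ZMod R) = ∏ j : ZMod R, F j := by
  refine Finset.prod_nbij (fun j : ℕ => (j : ZMod R)) (fun _ _ => Finset.mem_univ _) ?_ ?_
    (fun _ _ => rfl)
  · intro a ha b hb hab
    exact natCast_zmod_injOn (Finset.mem_range.1 ha) (Finset.mem_range.1 hb) hab
  · intro j _
    exact ⟨j.val, Finset.mem_range.2 (ZMod.val_lt j), ZMod.natCast_zmod_val j⟩

omit [NeZero C] in
/-- The column product of unit blocks over `j < R` is the column's plaquette product. [folklore] -/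
theorem prod_range_blockF_unit (p : ℝ → G → ℝ) (D : TorusData ι C R) (U : ι → G) (i : ZMod C) :
    ∏ j ∈ Finset.range R, blockF p D U i j (j + 1) =
      ∏ j : ZMod R, ENNReal.ofReal (p (D.σ i * D.τ j) (plaq D U i j)) := by
  simp only [blockF_unit]
  exact prod_range_natCast (fun j => ENNReal.ofReal (p (D.σ i * D.τ j) (plaq D U i j)))

/-- **Initial stage**: heights `kf = 1`, `lf = n₂ + 1` give the model integrand. [folklore] -/
theorem stageF_init (p : ℝ → G → ℝ) (f : G → ℝ) (D : TorusData ι C R) (n₁ n₂ : ℕ) (h1 : 1 ≤ n₂)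
    (h2 : n₂ < R) (U : ι → G) :
    stageF p f D n₁ n₂ (fun _ => 1) (fun _ => n₂ + 1) U = modelI p f D n₁ n₂ U := by
  unfold stageF modelI modelW
  congr 1
  refine Finset.prod_congr rfl fun i _ => ?_
  rw [← prod_range_blockF_unit]
  have e1 : blockF p D U i 0 1 = ∏ j ∈ Finset.Ico 0 1, blockF p D U i j (j + 1) := by simp
  have e2 : blockF p D U i n₂ (n₂ + 1) = ∏ j ∈ Finset.Ico n₂ (n₂ + 1), blockF p D U i j (j + 1) := by
    simp
  rw [e1, e2, Finset.prod_Ico_consecutive _ (Nat.zero_le 1) h1,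
    Finset.prod_Ico_consecutive _ (Nat.le_succ n₂) (Nat.succ_le_of_lt h2),
    Finset.prod_Ico_consecutive _ (Nat.zero_le n₂) (by omega : n₂ ≤ R), Finset.range_eq_Ico]

/-- The final-stage integrand written in terms of the column products
`B i = U(v i 0) ⋯ U(v i (n₂-1))`, `V i = U(v i n₂) ⋯ U(v i (R-1))` as free parameters. [folklore] -/
def finalF (p : ℝ → G → ℝ) (f : G → ℝ) (D : TorusData ι C R) (n₁ n₂ : ℕ) (B V : ZMod C → G)
    (U : ι → G) : ℝ≥0∞ :=
  ENNReal.ofReal (f (icoProd D.h U 0 0 n₁ * B n₁ * (icoProd D.h U (n₂ : ZMod R) 0 n₁)⁻¹ * (B 0)⁻¹)) *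
    ∏ i : ZMod C,
      (ENNReal.ofReal (p (D.σ i * ∑ j ∈ Finset.range n₂, D.τ j)
          (U (D.h 0 i) * B (i + 1) * (U (D.h n₂ i))⁻¹ * (B i)⁻¹)) *
        ENNReal.ofReal (p (D.σ i * ∑ j ∈ Finset.Ico n₂ R, D.τ j)
          (U (D.h n₂ i) * V (i + 1) * (U (D.h 0 i))⁻¹ * (V i)⁻¹)))

omit [NeZero R] in
/-- **Final stage**: heights `kf = n₂`, `lf = R` give `finalF` at the column products. [folklore] -/
theorem stageF_final (p : ℝ → G → ℝ) (f : G → ℝ) (D : TorusData ι C R) (n₁ n₂ : ℕ)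
    (U : ι → G) :
    stageF p f D n₁ n₂ (fun _ => n₂) (fun _ => R) U =
      finalF p f D n₁ n₂ (fun i => icoProd D.v U i 0 n₂) (fun i => icoProd D.v U i n₂ R) U := by
  unfold stageF finalF modelHol blockF
  simp only [Finset.Ico_self, Finset.prod_empty, mul_one, Nat.cast_zero, ZMod.natCast_self,
    Finset.range_eq_Ico]

/-- The reduced two-row model integrand is `finalF` at the renamed variables
`B i = U(v i 0)`, `V i = U(v i n₂)`. [folklore] -/
theorem modelI_reduce (p : ℝ → G → ℝ) (f : G → ℝ) (D : TorusData ι C R) (n₁ n₂ : ℕ)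
    (U : ι → G) :
    modelI p f (D.reduce n₂) n₁ 1 U =
      finalF p f D n₁ n₂ (fun i => U (D.v i 0)) (fun i => U (D.v i n₂)) U := by
  have h10 : (1 : ZMod 2) ≠ 0 := by decide
  have h11 : (1 : ZMod 2) + 1 = 0 := by decide
  have hprod : ∀ F : ZMod 2 → ℝ≥0∞, ∏ j : ZMod 2, F j = F 0 * F 1 := fun F =>
    Fin.prod_univ_two F
  unfold modelI finalF modelW modelHol
  simp only [hprod, plaq, TorusData.reduce, icoProd, if_pos, h11, zero_add, Nat.cast_one,
    one_ne_zero]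
  simp

end Stage

/-! ### Bookkeeping definitions for the integrations (files V, VI) -/

section Bookkeeping

variable {C R : ℕ} (p : ℝ → G → ℝ) (D : TorusData ι C R)

/-- The column-`i` factor of `stageF`: bottom block `[0, kf i)`, unit plaquettes on
`[kf i, n₂)`, top block `[n₂, lf i)`, unit plaquettes on `[lf i, R)`. [folklore] -/
def colF (n₂ : ℕ) (kf lf : ZMod C → ℕ) (U : ι → G) (i : ZMod C) : ℝ≥0∞ :=
  blockF p D U i 0 (kf i) * (∏ j ∈ Finset.Ico (kf i) n₂, blockF p D U i j (j + 1)) *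
    (blockF p D U i n₂ (lf i) * ∏ j ∈ Finset.Ico (lf i) R, blockF p D U i j (j + 1))

/-- The horizontal edges of the rows `a ≤ j < b` (the coordinates integrated by the chains). [folklore] -/
def rowEdges [NeZero C] [DecidableEq ι] (a b : ℕ) : Finset ι :=
  ((Finset.Ico a b) ×ˢ (Finset.univ : Finset (ZMod C))).image fun ji => D.h ji.1 ji.2

/-- Bottom column products `U(v i 0) ⋯ U(v i (n₂-1))`, renamed to the single variable `U(v i 0)`
on the columns `i ∈ S`. [folklore] -/
def bcol (n₂ : ℕ) (S : Finset (ZMod C)) (U : ι → G) (i : ZMod C) : G :=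
  if i ∈ S then U (D.v i 0) else icoProd D.v U i 0 n₂

/-- Top column products `U(v i n₂) ⋯ U(v i (R-1))`, renamed to the single variable `U(v i n₂)`
on the columns `i ∈ T`. [folklore] -/
def tcol (n₂ : ℕ) (T : Finset (ZMod C)) (U : ι → G) (i : ZMod C) : G :=
  if i ∈ T then U (D.v i n₂) else icoProd D.v U i n₂ R

end Bookkeeping

/-! ### The square lattice torus as a torus datum -/

section Lattice

/-- The torus datum of the two-dimensional lattice torus `(ℤ/M)²` of
`ConstructiveQFT`/`GaugeGroups` (configurations `GaugeConfig 2 M G = Edge 2 M → G`): the site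
`(i, j)` is `![i, j] : Fin 2 → ZMod M`, its horizontal edge is `(![i, j], 0)`, its vertical edge
`(![i, j], 1)`, and every plaquette carries the heat kernel at time `t` (`σ = 1`, `τ = t`), as in
`groupHeatKernelWeight p t`. [folklore] -/
def latticeTorus (M : ℕ) (t : ℝ) : TorusData (Edge 2 M) M M where
  σ _ := 1
  τ _ := t
  h j i := (![i, j], 0)
  v i j := (![i, j], 1)

/-- The lattice torus datum is well formed for `t > 0`. [folklore] -/
theorem isWF_latticeTorus (M : ℕ) {t : ℝ} (ht : 0 < t) : (latticeTorus M t).IsWF where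
  σ_pos _ := one_pos
  τ_pos _ := ht
  h_inj j i j' i' h := by
    simp only [latticeTorus, Prod.mk.injEq, and_true] at h
    exact ⟨by simpa using congr_fun h 1, by simpa using congr_fun h 0⟩
  v_inj i j i' j' h := by
    simp only [latticeTorus, Prod.mk.injEq, and_true] at h
    exact ⟨by simpa using congr_fun h 0, by simpa using congr_fun h 1⟩
  h_ne_v j i i' j' h := by
    simp only [latticeTorus, Prod.mk.injEq] at h
    exact absurd h.2 (by decide)

end Lattice

end Literature.MathematicalPhysics.QuantumFieldTheory.YM2
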